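import Summits.CriticalPhenomena.PercolationContinuityZ3.Theorems.PercNearOneGluingNoHeavyPcintAdaptiveDomination
import HarnessLib

/-!
# PCINT lane, king route, K1 step (2S): the cluster exploration rule and its terminal states

Cell `prim-pcint`, seat `prim-pcint-1` (gen 9); memo `run/shared/lean/prim/pcint/KING-ROUTE.md` §K1 (2S).

The exploration rule shared by the two processes of `AdaptDom.expect_le_of_dominating`
(`…PcintAdaptiveDomination.lean`) in van den Berg–Ermakov's comparison (Random Struct. Alg. 8 (1996), §3:
"at the `n`th step we select the vertex `v` which is lowest in order, has been inspected before and received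
`ξ`-value `1`, and has at least one neighbor that has not yet received a `ξ`-value … assign to each child of `v`
the `ξ`-value"), for a finite graph `G` on `V` with a root `o` and a ranking `enc : V → ℕ`:

* `ClusterExpl.rule G enc o σ` — from the empty state examine `{o}`; otherwise examine all unrevealed
  neighbours of the `enc`-least revealed-TRUE site having one (`sel`); `∅` if there is none (terminal).
* `rule_unrevealed` (the rule examines only unrevealed sites — hypothesis `hR` of `AdaptDom`),
  `rule_run_card_succ` (after `|V| + 1` steps every run is terminal, whatever the oracle),
  `isClosed_of_rule_eq_empty` (at a terminal state every neighbour of a revealed-true site is revealed),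
  `run_root_ne_none` (the root is revealed from step `1` on),
  `mem_revealedTrue_of_openPath` (at a terminal state, an open path from the root in ANY completion of the
  state runs inside the revealed-true sites), whence
* `reach_determined` — the payoff `F = 𝟙{the root is joined to the target set B by open sites}`
  (`reachIndicator`, monotone: `reachIndicator_mono`) is determined at terminal states (hypothesis `hdet`).
-/

namespace Summit.CriticalPhenomena.PercolationContinuityZ3.Theorems.Pcint

namespace ClusterExpl

open Finset AdaptDom

variable {V : Type*} [Fintype V] [DecidableEq V] (G : SimpleGraph V) [DecidableRel G.Adj] (enc : V → ℕ) (o : V)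

/-! ### The rule -/

/-- The candidates for selection: revealed-true sites with an unrevealed neighbour. -/
def cands (σ : V → Option Bool) : Finset V :=
  univ.filter fun v => σ v = some true ∧ ∃ w, G.Adj v w ∧ σ w = none

/-- The selected site: the `enc`-least candidate, if any. -/
noncomputable def sel (σ : V → Option Bool) : Option V :=
  if h : (cands G σ).Nonempty then some (Classical.choose (exists_min_image (cands G σ) enc h)) else none

omit [DecidableEq V] in
/-- The selected site is a candidate of least rank. -/
theorem sel_spec {σ : V → Option Bool} {b : V} (hb : sel G enc σ = some b) :
    b ∈ cands G σ ∧ ∀ b' ∈ cands G σ, enc b ≤ enc b' := by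
  unfold sel at hb
  split_ifs at hb with h
  · have := Classical.choose_spec (exists_min_image (cands G σ) enc h)
    rw [Option.some.injEq] at hb
    rw [← hb]
    exact this

omit [DecidableEq V] in
/-- No site is selected iff there is no candidate. -/
theorem sel_eq_none_iff {σ : V → Option Bool} : sel G enc σ = none ↔ cands G σ = ∅ := by
  unfold sel
  split_ifs with h
  · simp only [false_iff]
    exact h.ne_empty
  · simp only [true_iff]
    exact not_nonempty_iff_eq_empty.1 h

/-- **The exploration rule**: from the empty state examine the root; otherwise the unrevealed neighbours of the
selected site; nothing if no site is selected. -/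
noncomputable def rule (σ : V → Option Bool) : Finset V :=
  if ∀ v, σ v = none then {o}
  else match sel G enc σ with
    | none => ∅
    | some b => univ.filter fun w => G.Adj b w ∧ σ w = none

omit [DecidableEq V] in
/-- **The rule examines only unrevealed sites.** -/
theorem rule_unrevealed (σ : V → Option Bool) (v : V) (hv : v ∈ rule G enc o σ) : σ v = none := by
  unfold rule at hv
  split_ifs at hv with h
  · exact h v
  · cases hsel : sel G enc σ with
    | none => rw [hsel] at hv; simp at hv
    | some b => rw [hsel] at hv; exact (mem_filter.1 hv).2.2

omit [DecidableEq V] in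
/-- At a non-initial state with no selected site the rule is empty. -/
theorem rule_eq_empty_of_sel_eq_none {σ : V → Option Bool} (hne : ¬ ∀ v, σ v = none) (hsel : sel G enc σ = none) :
    rule G enc o σ = ∅ := by
  unfold rule; rw [if_neg hne, hsel]

omit [DecidableEq V] in
/-- At a non-initial state, if the rule is empty then no site is selected. -/
theorem sel_eq_none_of_rule_eq_empty {σ : V → Option Bool} (hne : ¬ ∀ v, σ v = none) (h : rule G enc o σ = ∅) :
    sel G enc σ = none := by
  unfold rule at h; rw [if_neg hne] at h
  cases hsel : sel G enc σ with
  | none => rfl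
  | some b =>
    exfalso
    simp only [hsel] at h
    obtain ⟨-, w, hbw, hw⟩ := (mem_filter.1 (sel_spec G enc hsel).1).2
    have : w ∈ (univ.filter fun w => G.Adj b w ∧ σ w = none) := mem_filter.2 ⟨mem_univ _, hbw, hw⟩
    rw [h] at this
    simp at this

omit [DecidableEq V] in
/-- **Terminal states are closed**: at a non-initial state where the rule is empty, every neighbour of a
revealed-true site is revealed. -/
theorem isClosed_of_rule_eq_empty {σ : V → Option Bool} (hne : ¬ ∀ v, σ v = none) (h : rule G enc o σ = ∅)
    {v w : V} (hv : σ v = some true) (hvw : G.Adj v w) : σ w ≠ none := by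
  intro hw
  have hsel := sel_eq_none_of_rule_eq_empty G enc o hne h
  rw [sel_eq_none_iff] at hsel
  have : v ∈ cands G σ := mem_filter.2 ⟨mem_univ _, hv, w, hvw, hw⟩
  rw [hsel] at this
  simp at this

/-! ### Revealed sites along a run -/

/-- The number of revealed sites. -/
def nrev (σ : V → Option Bool) : ℕ := (univ.filter fun v => σ v ≠ none).card

omit [Fintype V] in
/-- A step does not un-reveal: revealed sites stay revealed with the same value. -/
theorem stepPA_of_ne_none {S : Finset V} {σ : V → Option Bool} (hS : ∀ v ∈ S, σ v = none) (x : V → Bool) {v : V}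
    (hv : σ v ≠ none) : stepPA S σ x v = σ v := by
  unfold stepPA
  by_cases h : v ∈ S
  · exact absurd (hS v h) hv
  · rw [if_neg h]

omit [Fintype V] in
/-- A step with an empty examination set does nothing. -/
theorem stepPA_empty (σ : V → Option Bool) (x : V → Bool) : stepPA ∅ σ x = σ := by
  funext v; simp [stepPA]

/-- A step on a nonempty set of unrevealed sites reveals strictly more sites. -/
theorem nrev_lt_nrev_stepPA {S : Finset V} {σ : V → Option Bool} (hS : ∀ v ∈ S, σ v = none) (hne : S.Nonempty)
    (x : V → Bool) : nrev σ < nrev (stepPA S σ x) := by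
  obtain ⟨a, ha⟩ := hne
  unfold nrev
  apply card_lt_card
  rw [ssubset_iff_of_subset]
  · refine ⟨a, mem_filter.2 ⟨mem_univ _, ?_⟩, fun h => (mem_filter.1 h).2 (hS a ha)⟩
    simp [stepPA, ha]
  · intro v hv
    refine mem_filter.2 ⟨mem_univ _, ?_⟩
    rw [stepPA_of_ne_none hS x (mem_filter.1 hv).2]
    exact (mem_filter.1 hv).2

/-- Along a run of `rule`, either the state at step `n` is terminal or at least `n + 1` sites are revealed at
step `n + 1`. -/
theorem nrev_run_ge (x : (V → Option Bool) → V → Bool) :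
    ∀ n : ℕ, (∃ k ≤ n, rule G enc o (run (rule G enc o) x k) = ∅) ∨ n + 1 ≤ nrev (run (rule G enc o) x (n + 1))
  | 0 => by
    by_cases h : rule G enc o (run (rule G enc o) x 0) = ∅
    · exact Or.inl ⟨0, le_rfl, h⟩
    · right
      have := nrev_lt_nrev_stepPA (rule_unrevealed G enc o (run (rule G enc o) x 0)) (nonempty_iff_ne_empty.2 h)
        (x (run (rule G enc o) x 0))
      change nrev (run (rule G enc o) x 0) < nrev (run (rule G enc o) x (0 + 1)) at this
      omega
  | n + 1 => by
    rcases nrev_run_ge x n with ⟨k, hk, hke⟩ | hge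
    · exact Or.inl ⟨k, hk.trans (Nat.le_succ n), hke⟩
    · by_cases h : rule G enc o (run (rule G enc o) x (n + 1)) = ∅
      · exact Or.inl ⟨n + 1, le_rfl, h⟩
      · right
        have := nrev_lt_nrev_stepPA (rule_unrevealed G enc o (run (rule G enc o) x (n + 1)))
          (nonempty_iff_ne_empty.2 h) (x (run (rule G enc o) x (n + 1)))
        change nrev (run (rule G enc o) x (n + 1)) < nrev (run (rule G enc o) x (n + 1 + 1)) at this
        omega

/-- Once terminal, the run is constant. -/
theorem run_eq_of_terminal (x : (V → Option Bool) → V → Bool) {k : ℕ}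
    (hk : rule G enc o (run (rule G enc o) x k) = ∅) : ∀ n, k ≤ n → run (rule G enc o) x n = run (rule G enc o) x k := by
  intro n hn
  induction n with
  | zero =>
    have : k = 0 := Nat.le_zero.1 hn
    subst this; rfl
  | succ n ih =>
    rcases Nat.lt_or_eq_of_le hn with h | h
    · have ih' := ih (Nat.lt_succ_iff.1 h)
      change stepPA (rule G enc o (run (rule G enc o) x n)) (run (rule G enc o) x n) (x (run (rule G enc o) x n)) = _
      rw [ih', hk, stepPA_empty]
    · rw [← h]

/-- **Termination**: after `|V| + 1` steps every run of `rule` is terminal, whatever the oracle. -/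
theorem rule_run_card_succ (x : (V → Option Bool) → V → Bool) :
    rule G enc o (run (rule G enc o) x (Fintype.card V + 1)) = ∅ := by
  rcases nrev_run_ge G enc o x (Fintype.card V) with ⟨k, hk, hke⟩ | hge
  · rw [run_eq_of_terminal G enc o x hke _ (hk.trans (Nat.le_succ _))]; exact hke
  · exfalso
    have : nrev (run (rule G enc o) x (Fintype.card V + 1)) ≤ Fintype.card V := by
      unfold nrev; exact (card_le_univ _)
    omega

/-- **The root is revealed from step `1` on.** -/
theorem run_root_ne_none (x : (V → Option Bool) → V → Bool) : ∀ n, 1 ≤ n → run (rule G enc o) x n o ≠ none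
  | 0, h => absurd h (by omega)
  | n + 1, _ => by
    change stepPA (rule G enc o (run (rule G enc o) x n)) (run (rule G enc o) x n) (x (run (rule G enc o) x n)) o ≠ none
    by_cases hinit : ∀ v, run (rule G enc o) x n v = none
    · have hr : rule G enc o (run (rule G enc o) x n) = {o} := by rw [rule, if_pos hinit]
      rw [hr]; simp [stepPA]
    · -- the state is not initial, so some step `≥ 1` happened before: the root was revealed at step 1
      have hn : 1 ≤ n := by
        rcases Nat.eq_zero_or_pos n with rfl | hpos
        · exact absurd (fun v => rfl) hinit
        · exact hpos
      have ih := run_root_ne_none x n hn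
      rw [stepPA_of_ne_none (rule_unrevealed G enc o _) _ ih]
      exact ih

/-! ### Open paths at terminal states and the payoff -/

/-- An open path from the root to `v` in the configuration `ω`: `ω o` and a chain of `G`-adjacent open sites. -/
def OpenPath (ω : V → Bool) (v : V) : Prop :=
  ω o = true ∧ Relation.ReflTransGen (fun a b => G.Adj a b ∧ ω b = true) o v

omit [Fintype V] [DecidableEq V] [DecidableRel G.Adj] in
/-- Open paths are monotone in the configuration. -/
theorem openPath_mono {ω ω' : V → Bool} (h : ∀ v, ω v ≤ ω' v) {v : V} (hp : OpenPath G o ω v) : OpenPath G o ω' v := by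
  obtain ⟨h0, hc⟩ := hp
  refine ⟨?_, ?_⟩
  · have := h o; rw [h0] at this; exact Bool.eq_true_of_true_le this
  · induction hc with
    | refl => exact Relation.ReflTransGen.refl
    | @tail a b _ hab ih =>
      refine ih.tail ⟨hab.1, ?_⟩
      have := h b; rw [hab.2] at this; exact Bool.eq_true_of_true_le this

omit [DecidableEq V] in
/-- **At a terminal state, open paths from the root in any completion stay inside the revealed-true sites.** -/
theorem mem_revealedTrue_of_openPath {σ : V → Option Bool} (hne : ¬ ∀ v, σ v = none) (h : rule G enc o σ = ∅)
    (ho : σ o ≠ none) {ω : V → Bool} {v : V} (hp : OpenPath G o (merge σ ω) v) : σ v = some true := by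
  obtain ⟨hroot, hchain⟩ := hp
  have hstart : σ o = some true := by
    unfold merge at hroot
    cases hσ : σ o with
    | none => exact absurd hσ ho
    | some b => rw [hσ] at hroot; simp only [Option.getD_some] at hroot; rw [hroot]
  induction hchain with
  | refl => exact hstart
  | @tail a b _ hab ih =>
    have hb : σ b ≠ none := isClosed_of_rule_eq_empty G enc o hne h ih hab.1
    have hωb := hab.2
    unfold merge at hωb
    cases hσ : σ b with
    | none => exact absurd hσ hb
    | some c => rw [hσ] at hωb; simp only [Option.getD_some] at hωb; rw [hωb]

open Classical in
/-- **The payoff**: `𝟙{some site of the target set B is joined to the root by open sites}`. -/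
noncomputable def reachIndicator (B : Finset V) (ω : V → Bool) : ℝ := if ∃ v ∈ B, OpenPath G o ω v then 1 else 0

omit [Fintype V] [DecidableEq V] [DecidableRel G.Adj] in
/-- The payoff is monotone in the configuration. -/
theorem reachIndicator_mono (B : Finset V) : Monotone (reachIndicator G o B) := by
  intro ω ω' h
  unfold reachIndicator
  by_cases h1 : ∃ v ∈ B, OpenPath G o ω v
  · obtain ⟨v, hv, hp⟩ := h1
    have h2 : ∃ v ∈ B, OpenPath G o ω' v := ⟨v, hv, openPath_mono G o (fun u => h u) hp⟩
    rw [if_pos ⟨v, hv, hp⟩, if_pos h2]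
  · rw [if_neg h1]; split_ifs <;> norm_num

omit [Fintype V] [DecidableEq V] [DecidableRel G.Adj] in
/-- An open path inside the revealed-true sites of `σ` is an open path in every completion of `σ`. -/
theorem openPath_merge_of_revealedTrue {σ : V → Option Bool} {v : V} (ho : σ o = some true)
    (hp : Relation.ReflTransGen (fun a b => G.Adj a b ∧ σ b = some true) o v) (ω : V → Bool) :
    OpenPath G o (merge σ ω) v := by
  refine ⟨by simp [merge, ho], ?_⟩
  induction hp with
  | refl => exact Relation.ReflTransGen.refl
  | @tail a b _ hab ih =>
    refine ih.tail ⟨hab.1, ?_⟩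
    simp [merge, hab.2]

omit [DecidableEq V] in
/-- At a terminal state with the root revealed, an open path in one completion is an open path in every
completion. -/
theorem openPath_merge_iff {σ : V → Option Bool} (hne : ¬ ∀ v, σ v = none) (h : rule G enc o σ = ∅)
    (ho : σ o ≠ none) (ω ω' : V → Bool) (v : V) : OpenPath G o (merge σ ω) v ↔ OpenPath G o (merge σ ω') v := by
  have key : ∀ ω ω' : V → Bool, OpenPath G o (merge σ ω) v → OpenPath G o (merge σ ω') v := by
    intro ω ω' hp
    have hstart : σ o = some true := mem_revealedTrue_of_openPath G enc o hne h ho ⟨hp.1, Relation.ReflTransGen.refl⟩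
    refine openPath_merge_of_revealedTrue G o hstart ?_ ω'
    -- transport the chain: every vertex on it is revealed-true
    obtain ⟨hroot, hchain⟩ := hp
    induction hchain with
    | refl => exact Relation.ReflTransGen.refl
    | @tail a b hab' hab ih =>
      refine Relation.ReflTransGen.tail ih ⟨hab.1, ?_⟩
      exact mem_revealedTrue_of_openPath G enc o hne h ho ⟨hroot, hab'.tail hab⟩
  exact ⟨key ω ω', key ω' ω⟩

/-- **The payoff is determined at terminal states** (hypothesis `hdet` of `AdaptDom.expect_le_of_dominating`):
for every oracle `x`, after `|V| + 1` steps the value of `reachIndicator` no longer depends on the completion. -/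
theorem reach_determined (B : Finset V) (x : (V → Option Bool) → V → Bool) (ω ω₀ : V → Bool) :
    reachIndicator G o B (merge (run (rule G enc o) x (Fintype.card V + 1)) ω) =
      reachIndicator G o B (merge (run (rule G enc o) x (Fintype.card V + 1)) ω₀) := by
  set σ := run (rule G enc o) x (Fintype.card V + 1) with hσ
  have hterm : rule G enc o σ = ∅ := rule_run_card_succ G enc o x
  have ho : σ o ≠ none := run_root_ne_none G enc o x _ (Nat.le_add_left 1 _)
  have hne : ¬ ∀ v, σ v = none := fun hall => ho (hall o)
  unfold reachIndicator
  have key : (∃ v ∈ B, OpenPath G o (merge σ ω) v) ↔ ∃ v ∈ B, OpenPath G o (merge σ ω₀) v :=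
    exists_congr fun v => and_congr_right fun _ => openPath_merge_iff G enc o hne hterm ho ω ω₀ v
  by_cases h1 : ∃ v ∈ B, OpenPath G o (merge σ ω) v
  · rw [if_pos h1, if_pos (key.1 h1)]
  · rw [if_neg h1, if_neg (mt key.2 h1)]

end ClusterExpl

end Summit.CriticalPhenomena.PercolationContinuityZ3.Theorems.Pcint
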